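import Literature.Probability.RandomPlanarGeometry.SLEHitAfter
import Literature.Probability.RandomPlanarGeometry.SLEBoundaryProximity
import Literature.Probability.RandomPlanarGeometry.SLERealAvoidance
import HarnessLib

/-!
# A unified hitting bound for the SLE_κ trace: balls about arbitrary points of the closed half-plane

Topic `Probability/RandomPlanarGeometry`; theorems and one constant. For `0 < κ < 8` (under
`HasSLETrace κ`) there is `C = C_κ` such that for every `ζ ≠ 0` with `im ζ ≥ 0` and every `r > 0`

  `P[dist(ζ, γ[0,∞)) ≤ r] ≤ C (r/|ζ|)^{m}`,   `m = min (1 - κ/8, 8/κ - 1)`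

(`Literature.Probability.RandomPlanarGeometry.measure_infDist_sleTrace_le_rpow_div_norm`). This packages the two
sharp one-point estimates of the tree into the single scale-invariant form used for "hidden targets"
in the two-point estimate (V. Beffara, *The dimension of the SLE curves* (2008), §3, proof of
Lemma 8 (i), where the target is shown to be small relative to its distance from the tip and then
"let `p(r)` be the probability that a chordal SLE_κ starting at `0` touches the circle `C(1, r)`";
G. F. Lawler, B. M. Werness (2013), Lemma 2.11 and Prop. 2.6):

* interior regime `2r ≤ im ζ`: the sharp interior estimate with the angular factor
  (`measure_infDist_sleTrace_le_sharp'`, Beffara's Prop. 4 upper half),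
  `C (r/im ζ)^{1-κ/8} Ĝ(re ζ/im ζ)` with `Ĝ = (im ζ/|ζ|)^{8/κ-1}` (`rsGhatSlope_critical_eq_sq`), and
  `(r/y)^{1-κ/8} (y/|ζ|)^{8/κ-1} ≤ (r/|ζ|)^m`;
* boundary regime `im ζ < 2r`, `16 r < |ζ|`: `B(ζ, r) ⊆ B(re ζ, 3r)` and the boundary proximity
  estimate (`measure_infDist_ofReal_sleTrace_le`, Alberts–Kozdron Thm 3.2 / LW Prop. 2.6) at the real
  point `re ζ`, `|re ζ| ≥ 0.99 |ζ|`; for `re ζ < 0` the estimate is transported by the reflection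
  symmetry of the trace (`identDistrib_sleTrace_negConj`) through the measurable near-set
  (`measure_infDist_sleTrace_le_negConj`, `measure_infDist_neg_ofReal_sleTrace_le`);
* `|ζ| ≤ 16 r`: the bound exceeds `1`.

## References

* V. Beffara, *The dimension of the SLE curves*, Ann. Probab. 36 (2008), Prop. 4 and proof of
  Lemma 8 (i). [Beffara2008]
* G. F. Lawler, B. M. Werness, *Multi-point Green's functions for SLE and an estimate of Beffara*,
  Ann. Probab. 41 (2013), Prop. 2.6, Lemma 2.11. [LawlerWerness2010]
* T. Alberts, M. J. Kozdron, *Intersection probabilities for a chordal SLE path and a semicircle*,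
  Electron. Commun. Probab. 13 (2008), Thm 3.2. [AlbertsKozdron2007]
-/

noncomputable section

open Set Filter MeasureTheory Metric Complex
open _root_.Topology
open UpperHalfPlane (upperHalfPlaneSet)
open scoped NNReal ENNReal Real ComplexConjugate

namespace Literature.Probability.RandomPlanarGeometry

open Loewner Literature.Probability.Process

variable {κ : ℝ≥0}

/-! ### Reflection symmetry of hitting probabilities -/

/-- **Hitting probabilities are symmetric under `ζ ↦ -conj ζ`** (the trace and its reflection have
the same law, `identDistrib_sleTrace_negConj`, applied to the measurable near-set event).
[cite: RohdeSchramm2005, Prop. 2.1] -/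
theorem measure_infDist_sleTrace_eq_negConj (hT : HasSLETrace κ) (p : ℂ) (t : ℝ) :
    preWienerMeasure {ω | infDist p (range (sleTrace κ ω)) ≤ t} =
      preWienerMeasure {ω | infDist (-conj p) (range (sleTrace κ ω)) ≤ t} := by
  set S : Set (ℝ≥0 → ℂ) := {γ | ((p, t), γ) ∈ nearSet} with hS
  have hSm : MeasurableSet S := measurable_prodMk_left measurableSet_nearSet
  have hlaw := identDistrib_sleTrace_negConj hT
  -- the two events agree a.e. with the preimages of `S`
  have h1 : {ω | infDist p (range (sleTrace κ ω)) ≤ t} =ᵐ[preWienerMeasure]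
      ((fun ω ↦ sleTrace κ ω) ⁻¹' S) := by
    filter_upwards [hT] with ω hω
    have hc : Continuous (sleTrace κ ω) := (isGeneratedByCurve_trace hω).continuous
    show (ω ∈ {ω | infDist p (range (sleTrace κ ω)) ≤ t}) = (ω ∈ (fun ω ↦ sleTrace κ ω) ⁻¹' S)
    simp only [mem_setOf_eq, mem_preimage, hS]
    exact propext (mem_nearSet_iff (x := (p, t)) hc).symm
  have hφ : Isometry fun z : ℂ ↦ -conj z := by
    intro z w
    simp only [edist_dist, dist_eq_norm]
    congr 1
    rw [show -conj z - -conj w = -(conj (z - w)) by rw [map_sub]; ring, norm_neg, Complex.norm_conj]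
  have h2 : {ω | infDist (-conj p) (range (sleTrace κ ω)) ≤ t} =ᵐ[preWienerMeasure]
      ((fun ω t ↦ -conj (sleTrace κ ω t)) ⁻¹' S) := by
    filter_upwards [hT] with ω hω
    have hc : Continuous (sleTrace κ ω) := (isGeneratedByCurve_trace hω).continuous
    have hc' : Continuous fun t ↦ -conj (sleTrace κ ω t) := (Complex.continuous_conj.comp hc).neg
    show (ω ∈ {ω | infDist (-conj p) (range (sleTrace κ ω)) ≤ t}) =
      (ω ∈ (fun ω t ↦ -conj (sleTrace κ ω t)) ⁻¹' S)
    simp only [mem_setOf_eq, mem_preimage, hS]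
    rw [propext (mem_nearSet_iff (x := (p, t)) hc')]
    -- `infDist p (range (-conj ∘ γ)) = infDist (-conj p) (range γ)`
    have hr : range (fun t ↦ -conj (sleTrace κ ω t)) = (fun z : ℂ ↦ -conj z) '' range (sleTrace κ ω) := by
      rw [← range_comp]; rfl
    have hp : p = (fun z : ℂ ↦ -conj z) (-conj p) := by simp
    simp only
    rw [hr, hp, Metric.infDist_image hφ, ← hp]
  rw [measure_congr h1, measure_congr h2]
  exact hlaw.measure_mem_eq hSm

/-- **Boundary proximity at negative real points**: the estimate of
`measure_infDist_ofReal_sleTrace_le` (`x > 0`) transported by reflection: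
`P[dist(x, γ) ≤ r |x|] ≤ C r^{8/κ-1}` for `x < 0`, `0 < r ≤ 1/4`.
[cite: AlbertsKozdron2007, Thm 3.2] [cite: Beffara2008, proof of Lemma 8 (i)] -/
theorem measure_infDist_neg_ofReal_sleTrace_le (hκ : 0 < κ) (hκ8 : κ < 8) (hT : HasSLETrace κ) :
    ∃ C : ℝ, 0 ≤ C ∧ ∀ {x : ℝ}, x < 0 → ∀ {r : ℝ}, 0 < r → r ≤ 1 / 4 →
      preWienerMeasure {ω | infDist (x : ℂ) (range (sleTrace κ ω)) ≤ r * |x|} ≤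
        ENNReal.ofReal (C * r ^ (8 / (κ : ℝ) - 1)) := by
  obtain ⟨C, hC0, hC⟩ := measure_infDist_ofReal_sleTrace_le hκ hκ8 hT
  refine ⟨C, hC0, fun {x} hx {r} hr hr4 ↦ ?_⟩
  have h := hC (neg_pos.2 hx) hr hr4
  rw [measure_infDist_sleTrace_eq_negConj hT]
  have h1 : -conj ((x : ℝ) : ℂ) = ((-x : ℝ) : ℂ) := by simp
  rw [h1, abs_of_neg hx]
  simpa using h

/-! ### The unified bound -/

variable (κ) in
/-- The exponent `m = min (1 - κ/8, 8/κ - 1)` of the unified hitting bound. [folklore] -/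
def hitExp : ℝ := min (1 - (κ : ℝ) / 8) (8 / (κ : ℝ) - 1)

/-- `m > 0` for `0 < κ < 8`. [folklore] -/
theorem hitExp_pos (hκ : 0 < κ) (hκ8 : κ < 8) : 0 < hitExp κ := by
  have h0 : (0 : ℝ) < κ := by exact_mod_cast hκ
  have h8 : (κ : ℝ) < 8 := by exact_mod_cast hκ8
  refine lt_min (by linarith) ?_
  have : (1 : ℝ) < 8 / κ := (one_lt_div h0).2 h8
  linarith

/-- `m ≤ 1 - κ/8`. [folklore] -/
theorem hitExp_le_left : hitExp κ ≤ 1 - (κ : ℝ) / 8 := min_le_left _ _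

/-- `m ≤ 8/κ - 1`. [folklore] -/
theorem hitExp_le_right : hitExp κ ≤ 8 / (κ : ℝ) - 1 := min_le_right _ _

/-- **Unified hitting bound for the SLE_κ trace.** For `0 < κ < 8` (under `HasSLETrace κ`) there
is `C ≥ 1` such that for every `ζ ≠ 0` with `im ζ ≥ 0` and every `r > 0`,
`P[dist(ζ, γ[0,∞)) ≤ r] ≤ C (r/|ζ|)^m`, `m = min (1 - κ/8, 8/κ - 1)`: interior points by Beffara's
Prop. 4 (upper half, with the angular factor `Ĝ = (im ζ/|ζ|)^{8/κ-1}`), points near the real axis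
by the boundary proximity estimate at `re ζ` (and its reflection).
[cite: Beffara2008, Prop. 4 and proof of Lemma 8 (i)] [cite: LawlerWerness2010, Prop. 2.6 and Lemma 2.11] -/
theorem measure_infDist_sleTrace_le_rpow_div_norm (hκ : 0 < κ) (hκ8 : κ < 8) (hT : HasSLETrace κ) :
    ∃ C : ℝ, 1 ≤ C ∧ ∀ {ζ : ℂ}, 0 ≤ ζ.im → ζ ≠ 0 → ∀ {r : ℝ}, 0 < r →
      preWienerMeasure {ω | infDist ζ (range (sleTrace κ ω)) ≤ r} ≤
        ENNReal.ofReal (C * (r / ‖ζ‖) ^ hitExp κ) := by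
  haveI := isProbabilityMeasure_preWienerMeasure'
  have hκ0 : (0 : ℝ) < κ := by exact_mod_cast hκ
  have hκ8' : (κ : ℝ) < 8 := by exact_mod_cast hκ8
  set m : ℝ := hitExp κ with hm
  have hm0 : 0 < m := hitExp_pos hκ hκ8
  set s : ℝ := 1 - (κ : ℝ) / 8 with hs
  set b : ℝ := 8 / (κ : ℝ) - 1 with hb
  have hb0 : 0 < b := by
    have : (1 : ℝ) < 8 / κ := (one_lt_div hκ0).2 hκ8'
    rw [hb]; linarith
  have hms : m ≤ s := hitExp_le_left
  have hmb : m ≤ b := hitExp_le_right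
  -- `u^a ≤ u^m` for `0 ≤ u ≤ 1`, `m ≤ a` (recall `m > 0`)
  have hmono : ∀ {u a : ℝ}, 0 ≤ u → u ≤ 1 → m ≤ a → u ^ a ≤ u ^ m := by
    intro u a hu0 hu1 hma
    rcases hu0.eq_or_lt with h | h
    · rw [← h, Real.zero_rpow hm0.ne', Real.zero_rpow (hm0.trans_le hma).ne']
    · exact Real.rpow_le_rpow_of_exponent_ge h hu1 hma
  have hbg : b = 2 * ghatExp κ := by rw [hb, ghatExp]; field_simp
  -- the three constants
  obtain ⟨C₁, hC₁⟩ := measure_infDist_sleTrace_le_sharp' hκ hκ8 hT (η := 1 / 2) (by norm_num) (by norm_num)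
  obtain ⟨C₂, hC₂0, hC₂⟩ := measure_infDist_ofReal_sleTrace_le hκ hκ8 hT
  obtain ⟨C₃, hC₃0, hC₃⟩ := measure_infDist_neg_ofReal_sleTrace_le hκ hκ8 hT
  set C : ℝ := (16 : ℝ) ^ m + max C₁ 0 + (C₂ + C₃) * 4 ^ b with hC
  have h16 : (1 : ℝ) ≤ (16 : ℝ) ^ m := Real.one_le_rpow (by norm_num) hm0.le
  have hC1 : 1 ≤ C := by
    have : 0 ≤ max C₁ 0 + (C₂ + C₃) * 4 ^ b := by positivity
    rw [hC]; linarith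
  refine ⟨C, hC1, fun {ζ} hζim hζ0 {r} hr ↦ ?_⟩
  set ρ : ℝ := ‖ζ‖ with hρ
  have hρ0 : 0 < ρ := norm_pos_iff.2 hζ0
  have hu0 : 0 ≤ r / ρ := by positivity
  -- case (A): `ρ ≤ 16 r`, the bound exceeds `1`
  by_cases hA : ρ ≤ 16 * r
  · refine prob_le_one.trans ?_
    rw [← ENNReal.ofReal_one]
    refine ENNReal.ofReal_le_ofReal ?_
    have h1 : (1 : ℝ) / 16 ≤ r / ρ := by
      rw [div_le_div_iff₀ (by norm_num) hρ0]; linarith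
    have h2 : (16 : ℝ) ^ m * (r / ρ) ^ m ≥ 1 := by
      rw [← Real.mul_rpow (by norm_num) hu0]
      refine Real.one_le_rpow ?_ hm0.le
      have : (16 : ℝ) * (r / ρ) ≥ 16 * (1 / 16) := by gcongr
      linarith
    have h3 : (16 : ℝ) ^ m * (r / ρ) ^ m ≤ C * (r / ρ) ^ m := by
      refine mul_le_mul_of_nonneg_right ?_ (Real.rpow_nonneg hu0 _)
      have : 0 ≤ max C₁ 0 + (C₂ + C₃) * 4 ^ b := by positivity
      rw [hC]; linarith
    linarith
  rw [not_le] at hA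
  have hu1 : r / ρ ≤ 1 := by rw [div_le_one hρ0]; linarith
  by_cases hB : 2 * r ≤ ζ.im
  · -- case (B): interior regime
    have hy : 0 < ζ.im := by linarith
    have hε : r ≤ (1 - 1 / 2) * ζ.im := by linarith
    refine (hC₁ hy hr hε).trans (ENNReal.ofReal_le_ofReal ?_)
    have hG : rsGhatSlope (1 - (κ : ℝ) / 8) κ (ζ.re / ζ.im) = (ζ.im / ρ) ^ b := by
      rw [rsGhatSlope_critical_eq_sq hκ hy, hbg, Real.rpow_mul (by positivity)]
      congr 1
      have hnz : ζ.re ^ 2 + ζ.im ^ 2 = ρ ^ 2 := by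
        rw [hρ, Complex.sq_norm, Complex.normSq_apply]; ring
      rw [hnz, ← div_pow, Real.rpow_two]
    rw [hG]
    have h1 : (r / ζ.im) ^ (1 - (κ : ℝ) / 8) ≤ (r / ζ.im) ^ m :=
      hmono (by positivity) (by rw [div_le_one hy]; linarith) hms
    have h2 : (ζ.im / ρ) ^ b ≤ (ζ.im / ρ) ^ m :=
      hmono (by positivity) (by rw [div_le_one hρ0, hρ]; exact Complex.im_le_norm ζ) hmb
    have h3 : (r / ζ.im) ^ m * (ζ.im / ρ) ^ m = (r / ρ) ^ m := by
      rw [← Real.mul_rpow (by positivity) (by positivity)]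
      congr 1
      field_simp
    calc C₁ * (r / ζ.im) ^ (1 - (κ : ℝ) / 8) * (ζ.im / ρ) ^ b
        ≤ max C₁ 0 * (r / ζ.im) ^ (1 - (κ : ℝ) / 8) * (ζ.im / ρ) ^ b := by
          gcongr
          exact le_max_left _ _
      _ ≤ max C₁ 0 * (r / ζ.im) ^ m * (ζ.im / ρ) ^ m := by gcongr
      _ = max C₁ 0 * (r / ρ) ^ m := by rw [mul_assoc, h3]
      _ ≤ C * (r / ρ) ^ m := by
          refine mul_le_mul_of_nonneg_right ?_ (Real.rpow_nonneg hu0 _)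
          have : 0 ≤ (C₂ + C₃) * 4 ^ b := by positivity
          rw [hC]; linarith [h16]
  · -- case (C): boundary regime, `im ζ < 2r`, `16 r < ρ`
    rw [not_le] at hB
    set x : ℝ := ζ.re with hx
    have hnz : x ^ 2 + ζ.im ^ 2 = ρ ^ 2 := by
      rw [hρ, Complex.sq_norm, Complex.normSq_apply]; ring
    have hxabs : (99 / 100 : ℝ) * ρ < |x| := by
      have h1 : ((99 / 100 : ℝ) * ρ) ^ 2 < x ^ 2 := by nlinarith [hζim]
      have h2 := sq_lt_sq.1 h1
      rwa [abs_of_pos (by positivity : (0 : ℝ) < 99 / 100 * ρ)] at h2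
    have hxpos : 0 < |x| := lt_trans (by positivity) hxabs
    have hx0 : x ≠ 0 := abs_pos.1 hxpos
    -- `B(ζ, r) ⊆ B(x, 3r)`
    have hdist : dist (x : ℂ) ζ = ζ.im := by
      rw [dist_eq_norm, show (x : ℂ) - ζ = -((ζ.im : ℝ) * I) by
        apply Complex.ext <;> simp [hx]]
      rw [norm_neg, norm_mul, Complex.norm_real, Complex.norm_I, mul_one, Real.norm_eq_abs,
        abs_of_nonneg hζim]
    set t : ℝ := 3 * r / |x| with ht
    have ht0 : 0 < t := by positivity
    have ht4 : t ≤ 1 / 4 := by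
      rw [ht, div_le_iff₀ hxpos]; nlinarith
    have htx : t * |x| = 3 * r := by rw [ht]; field_simp
    have hsub : {ω | infDist ζ (range (sleTrace κ ω)) ≤ r} ⊆
        {ω | infDist (x : ℂ) (range (sleTrace κ ω)) ≤ t * |x|} := by
      intro ω hω
      have h1 := infDist_le_infDist_add_dist (x := (x : ℂ)) (y := ζ) (s := range (sleTrace κ ω))
      show infDist (x : ℂ) (range (sleTrace κ ω)) ≤ t * |x|
      rw [htx, hdist] at *
      have : infDist ζ (range (sleTrace κ ω)) ≤ r := hω
      linarith
    -- the boundary estimate at `x` (either sign)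
    have hbd : preWienerMeasure {ω | infDist (x : ℂ) (range (sleTrace κ ω)) ≤ t * |x|} ≤
        ENNReal.ofReal ((C₂ + C₃) * t ^ b) := by
      rcases lt_or_gt_of_ne hx0 with hneg | hpos
      · refine (hC₃ hneg ht0 ht4).trans (ENNReal.ofReal_le_ofReal ?_)
        nlinarith [Real.rpow_nonneg ht0.le b]
      · have h := hC₂ hpos ht0 ht4
        rw [abs_of_pos hpos]
        refine h.trans (ENNReal.ofReal_le_ofReal ?_)
        nlinarith [Real.rpow_nonneg ht0.le b]
    refine ((measure_mono hsub).trans hbd).trans (ENNReal.ofReal_le_ofReal ?_)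
    -- `t ≤ 4 r/ρ`, so `t^b ≤ 4^b (r/ρ)^b ≤ 4^b (r/ρ)^m`
    have htle : t ≤ 4 * (r / ρ) := by
      rw [ht, div_le_iff₀ hxpos]
      have : 4 * (r / ρ) * |x| = 4 * r * (|x| / ρ) := by ring
      rw [this]
      have h99 : (99 / 100 : ℝ) < |x| / ρ := by rwa [lt_div_iff₀ hρ0]
      nlinarith
    have h1 : t ^ b ≤ (4 * (r / ρ)) ^ b := Real.rpow_le_rpow ht0.le htle hb0.le
    have h2 : (4 * (r / ρ)) ^ b = 4 ^ b * (r / ρ) ^ b := Real.mul_rpow (by norm_num) hu0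
    have h3 : (r / ρ) ^ b ≤ (r / ρ) ^ m := hmono hu0 hu1 hmb
    have h4b : (0 : ℝ) ≤ 4 ^ b := by positivity
    calc (C₂ + C₃) * t ^ b ≤ (C₂ + C₃) * (4 ^ b * (r / ρ) ^ m) := by
          refine mul_le_mul_of_nonneg_left ?_ (by positivity)
          calc t ^ b ≤ 4 ^ b * (r / ρ) ^ b := h1.trans_eq h2
            _ ≤ 4 ^ b * (r / ρ) ^ m := mul_le_mul_of_nonneg_left h3 h4b
      _ = (C₂ + C₃) * 4 ^ b * (r / ρ) ^ m := by ring
      _ ≤ C * (r / ρ) ^ m := by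
          refine mul_le_mul_of_nonneg_right ?_ (Real.rpow_nonneg hu0 _)
          have : 0 ≤ max C₁ 0 := le_max_right _ _
          rw [hC]; linarith [h16]

end Literature.Probability.RandomPlanarGeometry

end
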